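import Literature.AnabelianGeometry.EtaleTheta.ThetaKummerClass
import Literature.AnabelianGeometry.EtaleTheta.KummerContH1Conj
import Literature.AnabelianGeometry.EtaleTheta.KummerContH1Kernel
import Literature.AnabelianGeometry.EtaleTheta.ContH1CoeffChange
import Mathlib.GroupTheory.OrderOfElement
import HarnessLib

/-!
# [EtTh] Prop. 1.4 (ii) «Θ̈(q_X^{a/2} Ü) = (−1)^a q_X^{−a²/2} Ü^{−2a} Θ̈(Ü)» at the level of Kummer classes:
# the ℤ-translates of the étale theta class differ from it by NON-TORSION classes

S. Mochizuki, *The étale theta function and its Frobenioid-theoretic manifestations*, Publ. RIMS **45**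
(2009), Prop. 1.4 (i), (ii) (PRIMS PDF pp. 247–248). Layer L2 of the abc-iut cell; sub-DAG
`plan/L2/SUBDAG-EtTh-Prop14.md` row P14/L09, second half = GAP-LEDGER G-w4d010-2 residual **(P14iii-cl)**
at the §1 (`Δ_Θ`-coefficient) level (seat abc-iut-w5-d125). PROOF-ONLY file (no definitions): every
function-level input enters as a HYPOTHESIS on abc-iut-L2-t12's `ThetaKummerInput` data (D-0067), exactly
as in `ThetaKummerDeck.lean` for the deck involution.

WHAT IS PROVED. Let `γ ∈ Π^tp_X` and suppose the function `Θ̈ ∈ T.Fn` satisfies the TRANSLATE IDENTITY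
of Prop. 1.4 (ii) along the powers of `γ`: `γᵏ • Θ̈ = c_k · Ü^{e k} · Θ̈` with constants `c_k ∈ K̈^×`, a fixed
exponent `e ≠ 0` (print: `e = ∓2`, «`Ü^{−2a}`») and the coordinate `Ü ∈ Fn^{Π^tp_Ÿ}` (p. 247: «a square root
`Ü ∈ Γ(Ü, O_Ü^×)`»). Then (`conj_zpow_kummerTheta_mul_inv_eq`) the class `(γᵏ·κ(Θ̈))·κ(Θ̈)⁻¹` IS the Kummer
class of the function `c_k · Ü^{e k}` (equivariance p413781 + multiplicativity), and
(`not_isOfFinOrder_comap_conj_zpow_kummerTheta`) for `k ≠ 0` its pull-back to ANY subgroup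
`H₀ ≤ K ≤ Π^tp_X` over `Π^tp_Ÿ` (abc-iut-L2-t8 instantiates `K := Π^tp_X̲̲`, `H₀ := Π^tp_Ÿ̲̲`) is NOT a torsion
class — provided (a) the coefficient map `Λ(Fn) → Δ_Θ` is bijective (p. 238 «`Δ_Θ ≅ Ẑ(1)`»), so that the
kernel of the continuous Kummer class consists of the elements with INVARIANT compatible roots
(`KummerContH1Kernel.lean`, p414345, here in pulled-back form `exists_isInvariant_of_comap_kummerContClass_eq_one`),
and (b) a ℚ-valued ORDER FUNCTION `ord : Fn →* Multiplicative ℚ` — the order of vanishing at a cusp / along a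
component, extended ℚ-linearly to the tempered coverings — kills the constants, is nonzero on `Ü` (a
coordinate: simple zero) and has BOUNDED DENOMINATORS on the functions fixed by `ι(H₀)` (functions on ONE
finite-level curve, where the valuation is discrete). [A ℤ-valued `ord` cannot do this on a group carrying
compatible roots of `Ü`: `ord(Ü^{1/N}) = ord(Ü)/N`; this is why `KummerContH1Kernel.map_eq_one_of_kummerContClass_eq_one`,
though correct, is applied here only in its ℚ-form.] The argument: if the class were torsion of exponent `M`,
then `(c_k Ü^{ek})^M` would have `ι(H₀)`-invariant `N`-th roots for every `N`, of order `M e k·ord(Ü)/N` with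
denominator `≤ d` — impossible for `N` large since `M e k · ord(Ü) ≠ 0`.

CONSUMER SHAPE (`EtaleThetaData.not_isOfFinOrder_comap_translate_of_kummer`): with `E.etaDd = T.kummerTheta`
(route R-8/R-9 of `ThetaKummerClass.lean`) this is VERBATIM the hypothesis `h14` of abc-iut-L2-t8's §2
transport `EtaleThetaDataOfSetting.hfree_of_etaDd_free` towards the binder `hfree` of
`Literature.IUT.HodgeArakelov.prop22_ii'_model` ([IUTchII] Prop. 2.2 (ii)).

No statement of [EtTh] is asserted; Prop. 1.4 is classical and undisputed; nothing here bears on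
[IUTchIII] Cor. 3.12. Universe `Type` as in `Setting.lean`.
-/

noncomputable section

namespace Literature.AnabelianGeometry.EtaleTheta

/-! ### Generic: powers of Kummer classes; the kernel of a pulled-back Kummer class -/

namespace CyclotomeCoefficients

variable {G G' : Type} [Group G] [TopologicalSpace G] [SeparatelyContinuousMul G]
  [Group G'] [TopologicalSpace G'] [IsTopologicalGroup G']
  {φ : G →* G'} {A' : Subgroup G'} [A'.Normal] [IsMulCommutative A']
  {A : Type} [CommGroup A] [MulDistribMulAction G A] [TopologicalSpace A]
  (c : CyclotomeCoefficients φ A' A) (H : Subgroup G) {a b : A}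

/-- Transport of a root system along an equality of the element does not change its Kummer class.
[cite: LANA2026Report, §6.1 p.31] -/
theorem kummerContClass_cast (x : RootSystem a) (e : a = b) (ha : a ∈ MulAction.fixedPoints H A)
    (hb : b ∈ MulAction.fixedPoints H A)
    (hx : ∀ n : ℕ+, IsOpen (MulAction.stabilizer G (x.root n) : Set G))
    (hx' : ∀ n : ℕ+, IsOpen (MulAction.stabilizer G ((x.cast e).root n) : Set G)) :
    c.kummerContClass H (x.cast e) hb hx' = c.kummerContClass H x ha hx := by
  subst e
  exact c.kummerContClass_eq H _ _ ha _ _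

omit [TopologicalSpace G] [SeparatelyContinuousMul G] [TopologicalSpace A] in
/-- Powers of invariants are invariant. [cite: LANA2026Report, §6.1 p.31] -/
theorem pow_mem_fixedPoints (ha : a ∈ MulAction.fixedPoints H A) (M : ℕ) :
    a ^ M ∈ MulAction.fixedPoints H A := fun h => by
  change (h : G) • a ^ M = a ^ M
  rw [smul_pow', show (h : G) • a = a from ha h]

/-- **Powers of a Kummer class are Kummer classes of powers**: for every `M` there is a compatible root
system of `a^M` (built from products) whose class is `κ(x)^M`. [cite: LANA2026Report, §6.1 p.31] -/
theorem exists_rootSystem_pow_kummerContClass_eq (hA : ∀ b : A, IsOpen (MulAction.stabilizer G b : Set G))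
    (x : RootSystem a) (ha : a ∈ MulAction.fixedPoints H A) (M : ℕ) :
    ∃ y : RootSystem (a ^ M),
      c.kummerContClass H y (pow_mem_fixedPoints H ha M) (fun _ => hA _) =
        c.kummerContClass H x ha (fun _ => hA _) ^ M := by
  induction M with
  | zero =>
    refine ⟨RootSystem.one.cast (pow_zero a).symm, ?_⟩
    rw [c.kummerContClass_cast H RootSystem.one (pow_zero a).symm (fun h => smul_one _)
      (pow_mem_fixedPoints H ha 0) (fun _ => hA _) (fun _ => hA _),
      c.kummerContClass_one H (fun h => smul_one _) (fun _ => hA _)]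
    exact (pow_zero _).symm
  | succ M ih =>
    obtain ⟨y, hy⟩ := ih
    refine ⟨(y.mul x).cast (pow_succ a M).symm, ?_⟩
    have hmul : a ^ M * a ∈ MulAction.fixedPoints H A := by
      rw [← pow_succ]; exact pow_mem_fixedPoints H ha (M + 1)
    rw [c.kummerContClass_cast H (y.mul x) (pow_succ a M).symm hmul (pow_mem_fixedPoints H ha (M + 1))
        (fun _ => hA _) (fun _ => hA _),
      c.kummerContClass_mul H y x (pow_mem_fixedPoints H ha M) ha hmul (fun _ => hA _) (fun _ => hA _)
        (fun _ => hA _), hy, pow_succ]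

variable {G₀ : Type} [Group G₀] [TopologicalSpace G₀] (ι : G₀ →* G) (hι : Continuous ι)
  {H₀ : Subgroup G₀}

omit [TopologicalSpace G] [SeparatelyContinuousMul G] [TopologicalSpace A] [TopologicalSpace G₀] in
/-- Invariants of `H` are invariants of `ι(H₀) ≤ H`. [cite: LANA2026Report, §6.1 p.31] -/
theorem mem_fixedPoints_map_of_le (hle : H₀.map ι ≤ H) (ha : a ∈ MulAction.fixedPoints H A) :
    a ∈ MulAction.fixedPoints (H₀.map ι) A := fun h => ha ⟨h.1, hle h.2⟩

/-- **Kernel of a pulled-back Kummer class.** If the coefficient map `Λ(A) → A'` is bijective and the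
pull-back of `κ(x)` along `ι : G₀ → G` to `H₀` (with `ι(H₀) ≤ H`) is trivial in `H¹(H₀, A')`, then `a`
admits a compatible system of roots all fixed by `ι(H₀)` (cf. `KummerContH1Kernel.lean` for `ι = id`).
[cite: LANA2026Report, §6.1 p.31] -/
theorem exists_isInvariant_of_comap_kummerContClass_eq_one (hle : H₀.map ι ≤ H)
    (hc : Function.Bijective c.hom) (x : RootSystem a) (ha : a ∈ MulAction.fixedPoints H A)
    (hx : ∀ n : ℕ+, IsOpen (MulAction.stabilizer G (x.root n) : Set G))
    (h1 : ContH1.comap φ A' ι hι hle (c.kummerContClass H x ha hx) = 1) :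
    ∃ y : RootSystem a, y.IsInvariant (H₀.map ι) := by
  rw [kummerContClass, ContH1.comap_mk, ← ContH1.mk_one, ContH1.mk_eq_mk_iff] at h1
  obtain ⟨α, hα⟩ := h1
  obtain ⟨ζ, rfl⟩ := hc.2 α
  refine ⟨x.mulCyclotome ζ⁻¹⁻¹,
    x.isInvariant_mulCyclotome_inv (H₀.map ι) (mem_fixedPoints_map_of_le H ι hle ha) ζ⁻¹ fun h => ?_⟩
  obtain ⟨h₀, hh₀, hh⟩ := h.2
  obtain rfl : h = ⟨ι h₀, h₀, hh₀, rfl⟩ := Subtype.ext hh.symm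
  have key := hα ⟨h₀, hh₀⟩
  rw [Pi.one_apply, mul_one] at key
  have hconj : MulAut.conjNormal ((φ.comp ι) (⟨h₀, hh₀⟩ : H₀)) (c.hom ζ) = c.hom (ι h₀ • ζ) :=
    (c.hom_smul (ι h₀) ζ).symm
  rw [hconj, ← map_inv, ← map_inv, ← map_mul, ← div_eq_mul_inv] at key
  -- `κ_x(ι h₀)⁻¹ = ι h₀ • ζ / ζ`, so `ι h₀ • ζ⁻¹ / ζ⁻¹ = κ_x(ι h₀)`
  have hinj := hc.1 key
  have hcoc : x.kummerCocycle (mem_fixedPoints_map_of_le H ι hle ha) ⟨ι h₀, h₀, hh₀, rfl⟩ =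
      x.kummerCocycle ha ⟨ι h₀, hle ⟨h₀, hh₀, rfl⟩⟩ := Subtype.ext rfl
  rw [hcoc]
  change ι h₀ • ζ⁻¹ / ζ⁻¹ = _
  rw [smul_inv', inv_div_inv, ← inv_div, ← hinj, inv_inv]

end CyclotomeCoefficients

/-! ### A ℚ-valued order function with bounded denominators kills nothing divisible; Archimedean step -/

/-- If `r ≠ 0` is rational, it is not the case that `r / N` has denominator dividing `d` for every
`N ≥ 1`. [folklore] -/
private theorem not_forall_exists_int_eq_div {r : ℚ} (hr : r ≠ 0) {d : ℕ} (hd : 0 < d) :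
    ¬ ∀ N : ℕ+, ∃ z : ℤ, r / N = z / d := by
  intro h
  obtain ⟨N, hN⟩ := exists_nat_gt (|r| * d)
  have hNpos : 0 < N + 1 := Nat.succ_pos N
  obtain ⟨z, hz⟩ := h ⟨N + 1, hNpos⟩
  have hd' : (0 : ℚ) < d := by exact_mod_cast hd
  have hN1 : (0 : ℚ) < (N + 1 : ℕ) := by exact_mod_cast hNpos
  -- `r d = z (N+1)` with `z ≠ 0`, so `|r| d ≥ N + 1 > N ≥ |r| d`: contradiction
  have hrd : r * d = z * ((N + 1 : ℕ) : ℚ) := by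
    have := hz
    rw [PNat.mk_coe] at this
    field_simp at this
    linarith [this]
  have hz0 : z ≠ 0 := by
    rintro rfl
    rw [Int.cast_zero, zero_mul] at hrd
    exact hr ((mul_eq_zero.mp hrd).resolve_right hd'.ne')
  have hz1 : (1 : ℚ) ≤ |(z : ℚ)| := by exact_mod_cast Int.one_le_abs hz0
  have habs : |r| * d = |(z : ℚ)| * ((N + 1 : ℕ) : ℚ) := by
    rw [← abs_of_pos hd', ← abs_mul, hrd, abs_mul, abs_of_pos hN1]
  have : ((N + 1 : ℕ) : ℚ) ≤ |r| * d := by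
    rw [habs]; exact le_mul_of_one_le_left hN1.le hz1
  push_cast at this
  linarith

namespace ThetaSetting

variable {p : ℕ} [Fact p.Prime] {D : ThetaSetting p}

namespace ThetaKummerInput

variable (T : D.ThetaKummerInput)

/-- `c · Ü^m` is fixed by `Π^tp_Ÿ` when `Ü` is. [cite: MochizukiEtTh2009, Prop 1.4 p.21] -/
theorem const_mul_zpow_mem (c : (↥D.Kdd)ˣ) {udd : T.Fn} (hu : udd ∈ MulAction.fixedPoints D.GtpYdd T.Fn)
    (m : ℤ) : T.const c * udd ^ m ∈ MulAction.fixedPoints D.GtpYdd T.Fn := fun h => by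
  change (h : D.PiTemp) • (T.const c * udd ^ m) = T.const c * udd ^ m
  rw [smul_mul', smul_zpow', show (h : D.PiTemp) • T.const c = T.const c from T.const_mem c h,
    show (h : D.PiTemp) • udd = udd from hu h]

/-- **The translate ratio is the Kummer class of `c · Ü^{e k}`.** If `γᵏ • Θ̈ = c · Ü^{ek} · Θ̈` in `Fn`
(Prop. 1.4 (ii), third equation, along `γᵏ`), then in `H¹(Π^tp_Ÿ, Δ_Θ)` (for `Π^tp_Ÿ ⊴ Π^tp_X`)
`(γᵏ · κ(Θ̈)) · κ(Θ̈)⁻¹ = κ(c · Ü^{ek})`, the latter computed from the root systems of `c` and of `Ü^{ek}`.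
[cite: MochizukiEtTh2009, Prop 1.4 (ii) p.22] -/
theorem conj_zpow_kummerTheta_mul_inv_eq [D.GtpYdd.Normal] {udd : T.Fn}
    (hu : udd ∈ MulAction.fixedPoints D.GtpYdd T.Fn) (γ : D.PiTemp) (m k : ℤ) (c : (↥D.Kdd)ˣ)
    (hk : (γ ^ k) • T.theta = T.const c * udd ^ m * T.theta) (w : RootSystem (udd ^ m)) :
    ContH1.conj D.toTheta D.DeltaTheta (γ ^ k) T.kummerTheta * T.kummerTheta⁻¹ =
      T.coeff.kummerContClass D.GtpYdd ((T.constRoots c).mul w) (T.const_mul_zpow_mem c hu m)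
        fun _ => T.isOpen_stabilizer _ := by
  have hprod : T.const c * udd ^ m * T.theta ∈ MulAction.fixedPoints D.GtpYdd T.Fn := fun h => by
    change (h : D.PiTemp) • (T.const c * udd ^ m * T.theta) = _
    rw [smul_mul', show (h : D.PiTemp) • (T.const c * udd ^ m) = T.const c * udd ^ m from
      T.const_mul_zpow_mem c hu m h, show (h : D.PiTemp) • T.theta = T.theta from T.theta_mem h]
  rw [kummerTheta, T.coeff.conj_kummerContClass_of_smul_eq D.GtpYdd (γ ^ k) T.thetaRoots
    (((T.constRoots c).mul w).mul T.thetaRoots) T.theta_mem hprod (fun _ => T.isOpen_stabilizer _)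
    (fun _ => T.isOpen_stabilizer _)
    (fun n => CyclotomeCoefficients.isOpen_stabilizer_smul_root (γ ^ k) T.thetaRoots
      (fun _ => T.isOpen_stabilizer _) n) hk,
    T.coeff.kummerContClass_mul D.GtpYdd ((T.constRoots c).mul w) T.thetaRoots
      (T.const_mul_zpow_mem c hu m) T.theta_mem hprod (fun _ => T.isOpen_stabilizer _)
      (fun _ => T.isOpen_stabilizer _) (fun _ => T.isOpen_stabilizer _), mul_inv_cancel_right]

/-- **(P14iii-cl), §1 level — the translates of `κ(Θ̈)` are non-torsion, PROVED from the function-level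
inputs.** Hypotheses (all on t12's `ThetaKummerInput` data; `Fn` has no carrier): the coordinate
`Ü ∈ Fn^{Π^tp_Ÿ}` with compatible roots of its powers (`xpow`); the translate identity of Prop. 1.4 (ii)
along the powers of `γ` with exponent `e ≠ 0`; bijectivity of `Λ(Fn) → Δ_Θ`; a ℚ-valued order function
killing constants, nonzero on `Ü`, with denominators bounded by `d` on `Fn^{ι(H₀)}`. Conclusion: for
`k ≠ 0`, the pull-back to `H₀ ≤ K` of `(γᵏ·κ(Θ̈))·κ(Θ̈)⁻¹` is not of finite order.
[cite: MochizukiEtTh2009, Prop 1.4 (i)-(ii) p.21-22] -/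
theorem not_isOfFinOrder_comap_conj_zpow_kummerTheta [D.GtpYdd.Normal] {udd : T.Fn}
    (hu : udd ∈ MulAction.fixedPoints D.GtpYdd T.Fn) (xpow : ∀ m : ℤ, RootSystem (udd ^ m))
    (γ : D.PiTemp) (e : ℤ) (he : e ≠ 0)
    (hpow : ∀ k : ℤ, ∃ c : (↥D.Kdd)ˣ, (γ ^ k) • T.theta = T.const c * udd ^ (e * k) * T.theta)
    (hcoeff : Function.Bijective T.coeff.hom)
    {K : Subgroup D.PiTemp} {H₀ : Subgroup K} (hle : H₀.map K.subtype ≤ D.GtpYdd)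
    (ord : T.Fn →* Multiplicative ℚ) (hordc : ∀ c, ord (T.const c) = 1) (hordu : ord udd ≠ 1)
    {d : ℕ} (hd : 0 < d)
    (hint : ∀ f ∈ MulAction.fixedPoints (H₀.map K.subtype) T.Fn, ∃ z : ℤ, Multiplicative.toAdd (ord f) = z / d)
    {k : ℤ} (hk : k ≠ 0) :
    ¬ IsOfFinOrder (ContH1.comap D.toTheta D.DeltaTheta K.subtype continuous_subtype_val hle
      (ContH1.conj D.toTheta D.DeltaTheta (γ ^ k) T.kummerTheta * T.kummerTheta⁻¹)) := by
  intro hfin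
  obtain ⟨c, hc⟩ := hpow k
  rw [T.conj_zpow_kummerTheta_mul_inv_eq hu γ (e * k) k c hc (xpow (e * k))] at hfin
  -- the class is torsion of some exponent `M ≥ 1`
  obtain ⟨M, hMpos, hM⟩ := (isOfFinOrder_iff_pow_eq_one.mp hfin)
  set g : T.Fn := T.const c * udd ^ (e * k) with hg
  have hgfix : g ∈ MulAction.fixedPoints D.GtpYdd T.Fn := T.const_mul_zpow_mem c hu (e * k)
  -- `κ(g)^M = κ(y)` for a root system `y` of `g^M`
  obtain ⟨y, hy⟩ := T.coeff.exists_rootSystem_pow_kummerContClass_eq D.GtpYdd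
    (fun _ => T.isOpen_stabilizer _) ((T.constRoots c).mul (xpow (e * k))) hgfix M
  rw [← map_pow, ← hy] at hM
  -- hence `g^M` has `ι(H₀)`-invariant compatible roots: it is an `N`-th power there for all `N`
  obtain ⟨y', hy'⟩ := T.coeff.exists_isInvariant_of_comap_kummerContClass_eq_one D.GtpYdd K.subtype
    continuous_subtype_val hle hcoeff y _ _ hM
  -- orders: `ord(g^M) = M e k · ord(Ü)` is nonzero …
  have hordg : Multiplicative.toAdd (ord (g ^ M)) =
      (M : ℚ) * (((e * k : ℤ) : ℚ) * Multiplicative.toAdd (ord udd)) := by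
    rw [map_pow, toAdd_pow, hg, map_mul, toAdd_mul, hordc, toAdd_one, zero_add, map_zpow, toAdd_zpow,
      nsmul_eq_mul, zsmul_eq_mul]
  have hu0 : Multiplicative.toAdd (ord udd) ≠ 0 := fun h0 => hordu (toAdd_eq_zero.mp h0)
  have hr : (M : ℚ) * (((e * k : ℤ) : ℚ) * Multiplicative.toAdd (ord udd)) ≠ 0 := by
    have hM0 : (M : ℚ) ≠ 0 := by exact_mod_cast hMpos.ne'
    have hek : ((e * k : ℤ) : ℚ) ≠ 0 := by exact_mod_cast mul_ne_zero he hk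
    exact mul_ne_zero hM0 (mul_ne_zero hek hu0)
  -- … but `g^M = b_N^N` with `b_N` fixed by `ι(H₀)`, so `ord(g^M)/N` has denominator `≤ d` for all `N`
  refine not_forall_exists_int_eq_div hr hd fun N => ?_
  obtain ⟨b, hb, hbN⟩ := hy'.exists_pow_eq N
  obtain ⟨z, hz⟩ := hint b hb
  refine ⟨z, ?_⟩
  have hNq : ((N : ℕ) : ℚ) ≠ 0 := by exact_mod_cast N.ne_zero
  have hmain : ((N : ℕ) : ℚ) * Multiplicative.toAdd (ord b) = Multiplicative.toAdd (ord (g ^ M)) := by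
    rw [← hbN, map_pow, toAdd_pow, nsmul_eq_mul]
  rw [hz, hordg] at hmain
  rw [div_eq_iff hNq, ← hmain]
  ring

end ThetaKummerInput

/-! ### The consumer shape for the étale theta class `η̈^Θ = κ(Θ̈)` -/

namespace EtaleThetaData

variable (T : D.ThetaKummerInput)

/-- **(P14iii-cl) for the étale theta class**, in the shape consumed by abc-iut-L2-t8's §2 transport
`EtaleThetaDataOfSetting.hfree_of_etaDd_free` (hypothesis `h14`, with `K := Π^tp_X̲̲`, `H₀ := Π^tp_Ÿ̲̲`,
`γ` a generator of `Π^tp_X̲̲/Π^tp_Y̲̲`): if `η̈^Θ` IS the Kummer class of `Θ̈` and the function-level inputs of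
`not_isOfFinOrder_comap_conj_zpow_kummerTheta` hold, then for every `k ≠ 0` the pull-back of
`(γᵏ · η̈^Θ) · (η̈^Θ)⁻¹` to `H₀` is not a torsion class. [cite: MochizukiEtTh2009, Prop 1.4 (ii) p.22] -/
theorem not_isOfFinOrder_comap_translate_of_kummer (E : D.EtaleThetaData) [D.GtpYdd.Normal]
    (hη : E.etaDd = T.kummerTheta) {udd : T.Fn} (hu : udd ∈ MulAction.fixedPoints D.GtpYdd T.Fn)
    (xpow : ∀ m : ℤ, RootSystem (udd ^ m)) (γ : D.PiTemp) (e : ℤ) (he : e ≠ 0)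
    (hpow : ∀ k : ℤ, ∃ c : (↥D.Kdd)ˣ, (γ ^ k) • T.theta = T.const c * udd ^ (e * k) * T.theta)
    (hcoeff : Function.Bijective T.coeff.hom)
    {K : Subgroup D.PiTemp} {H₀ : Subgroup K} (hle : H₀.map K.subtype ≤ D.GtpYdd)
    (ord : T.Fn →* Multiplicative ℚ) (hordc : ∀ c, ord (T.const c) = 1) (hordu : ord udd ≠ 1)
    {d : ℕ} (hd : 0 < d)
    (hint : ∀ f ∈ MulAction.fixedPoints (H₀.map K.subtype) T.Fn, ∃ z : ℤ, Multiplicative.toAdd (ord f) = z / d) :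
    ∀ k : ℤ, k ≠ 0 → ¬ IsOfFinOrder (ContH1.comap D.toTheta D.DeltaTheta K.subtype continuous_subtype_val hle
      (ContH1.conj D.toTheta D.DeltaTheta (γ ^ k) E.etaDd * E.etaDd⁻¹)) := by
  intro k hk
  rw [hη]
  exact T.not_isOfFinOrder_comap_conj_zpow_kummerTheta hu xpow γ e he hpow hcoeff hle ord hordc hordu hd
    hint hk

end EtaleThetaData

end ThetaSetting

end Literature.AnabelianGeometry.EtaleTheta

end
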